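import Mathlib
import Literature.NumberTheory.Transcendental.KZCalculus
import Summits.KontsevichZagierPeriods.KontsevichZagierPeriods.Theses.UnfoldedStokes
import Summits.KontsevichZagierPeriods.KontsevichZagierPeriods.Theorems.UnfoldedStokesHyperellipticRiemannRelationStubKernelIntegrableAux

/-!
# `HyperellipticRiemannRelation` (stmt-KontsevichZagierPeriods-3522), line `SketchIdeator2` —
# stub `stub_kernelIntegrable`

Absolute integrability of the two bulk integrands of the fibred half-plane transport on the open
prisms: `B = Re K′/(1−σ)²` (simplex kernel, prism `{u > 0} × ℝ × (0,1)`) and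
`B₁ = −ρ(x₀) Im k′/(1−σ)²` (spectator kernel, prism `J_L × ℝ × (0,1)`). Both are dominated, off a
null set of branch lines, by a product `c · h(σ) · P(w₀, w₁)` of an integrable one-variable height
weight `h(σ) = ν(σ/(1−σ))/(1−σ)²` (`ν` from `stub_bounds`, transported along `s = σ/(1−σ)`) and an
integrable planar weight `P` (`m(τ−u) m(τ)` resp. `m(a) m(τ)`, `m` from `stub_bounds`; Tonelli and
the measure-preserving shear), and such products are integrable on `ℝ³` (transport along
`ℝ³ ≃ ℝ × ℝ²`); the one-variable facts, the null sets and the pointwise bound on `K′`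
(`stub_kernelIntegrableAux`) are in the auxiliary file. The pointwise kernel bounds themselves are
the HYPOTHESIS supplied by `stub_bounds`.

References: Kontsevich–Zagier 2001 §1.1 (absolute convergence is part of the data of a period);
folklore real analysis.
-/

noncomputable section

namespace Summit.KontsevichZagierPeriods.UnfoldedStokes.HyperellipticRiemannRelationLine

open Set MeasureTheory Filter Topology
open Literature.NumberTheory.Transcendental
open Literature.ModelTheory.ExponentialFields (IsSemialgebraic)
open KernelIntegrable

/-! ## The stub -/

/-- **Stub `stub_kernelIntegrable`.** Absolute integrability of the simplex bulk
`B = Re K′/(1−σ)²` on the prism `{u > 0} × ℝ × (0,1)` and of the spectator bulk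
`B₁ = −ρ(x₀) Im k′/(1−σ)²` on the prisms `J_L × ℝ × (0,1)`: both are dominated off the (null)
branch lines by `c · h(σ) · P(w₀, w₁)` with `h` the transported height weight of `stub_bounds` and `P`
a (sheared) product of the integrable weight `m`. [folklore] -/
theorem stub_kernelIntegrable :
    ∀ (e : Fin 5 → ℚ), StrictMono e →
    ∀ (Φ : ℂ → ℂ), (∀ z, Φ z = ∏ j : Fin 5, Complex.sqrt (z - ((e j : ℝ) : ℂ))) →
    ∀ (m : ℝ → ℝ), (∀ x, m x =
        (1 + ∑ k : Fin 5, |x - (e k : ℝ)| ^ (-(3:ℝ) / 4)) * (1 + x ^ 2) ^ (-(5:ℝ) / 8)) →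
    (Integrable m ∧
      IntegrableOn (fun s : ℝ => (1 + s ^ (-(3:ℝ) / 4)) * (1 + s ^ 2) ^ (-(5:ℝ) / 8)) (Ioi 0) ∧
      IntegrableOn (fun s : ℝ => (1 + s ^ (-(3:ℝ) / 4)) * (1 + s ^ 2) ^ (-(5:ℝ) / 4)) (Ioi 0) ∧
      ∃ C : ℝ, 0 < C ∧ ∀ (x s : ℝ), 0 ≤ s → (∀ j, x ≠ (e j : ℝ)) →
        ‖(Φ ((x : ℂ) + (s : ℂ) * Complex.I))⁻¹‖ ≤ C * m x * (1 + s ^ 2) ^ (-(5:ℝ) / 8) ∧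
        ‖((x : ℂ) + (s : ℂ) * Complex.I) / Φ ((x : ℂ) + (s : ℂ) * Complex.I)‖ ≤
          C * m x * (1 + s ^ 2) ^ (-(1:ℝ) / 8) ∧
        (0 < s →
          ‖(Φ ((x : ℂ) + (s : ℂ) * Complex.I))⁻¹ *
              ∑ j : Fin 5, ((x : ℂ) + (s : ℂ) * Complex.I - ((e j : ℝ) : ℂ))⁻¹‖ ≤
            C * m x * (1 + s ^ (-(3:ℝ) / 4)) * (1 + s ^ 2) ^ (-(9:ℝ) / 8) ∧
          ‖(1 - ((x : ℂ) + (s : ℂ) * Complex.I) / 2 *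
                ∑ j : Fin 5, ((x : ℂ) + (s : ℂ) * Complex.I - ((e j : ℝ) : ℂ))⁻¹) /
              Φ ((x : ℂ) + (s : ℂ) * Complex.I)‖ ≤
            C * m x * (1 + s ^ (-(3:ℝ) / 4)) * (1 + s ^ 2) ^ (-(5:ℝ) / 8))) →
    (∀ (K' : ℝ → ℝ → ℝ → ℂ) (B : (Fin 3 → ℝ) → ℝ),
      (∀ x₀ x₁ s, K' x₀ x₁ s =
        (1 - ((x₁ : ℂ) + (s : ℂ) * Complex.I) / 2 *
          ∑ j : Fin 5, (((x₀ : ℂ) + (s : ℂ) * Complex.I - ((e j : ℝ) : ℂ))⁻¹ +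
            ((x₁ : ℂ) + (s : ℂ) * Complex.I - ((e j : ℝ) : ℂ))⁻¹)) /
        (Φ ((x₀ : ℂ) + (s : ℂ) * Complex.I) * Φ ((x₁ : ℂ) + (s : ℂ) * Complex.I))) →
      (∀ w, B w = 1 / (1 - w 2) ^ 2 * (K' (w 1 - w 0) (w 1) (w 2 / (1 - w 2))).re) →
      IntegrableOn B {w : Fin 3 → ℝ | w 0 ∈ Ioi (0:ℝ) ∧ 0 < w 2 ∧ w 2 < 1}) ∧
    (∀ (ρ : ℝ → ℝ) (k' : ℝ → ℝ → ℂ) (B : (Fin 3 → ℝ) → ℝ),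
      (∀ t, ρ t = 1 / Real.sqrt |∏ i : Fin 5, (t - (e i : ℝ))|) →
      (∀ x s, k' x s = (1 - ((x : ℂ) + (s : ℂ) * Complex.I) / 2 *
          ∑ j : Fin 5, ((x : ℂ) + (s : ℂ) * Complex.I - ((e j : ℝ) : ℂ))⁻¹) /
        Φ ((x : ℂ) + (s : ℂ) * Complex.I)) →
      (∀ w, B w = -(1 / (1 - w 2) ^ 2 * ρ (w 0) * (k' (w 1) (w 2 / (1 - w 2))).im)) →
      ∀ L : Fin 6,
      IntegrableOn B {w : Fin 3 → ℝ | w 0 ∈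
          (![Set.Iio (e 0 : ℝ), Set.Ioo (e 0 : ℝ) (e 1 : ℝ), Set.Ioo (e 1 : ℝ) (e 2 : ℝ),
             Set.Ioo (e 2 : ℝ) (e 3 : ℝ), Set.Ioo (e 3 : ℝ) (e 4 : ℝ), Set.Ioi (e 4 : ℝ)] : Fin 6 → Set ℝ) L ∧
        0 < w 2 ∧ w 2 < 1})  := by
  intro e he Φ hΦ m hm hbounds
  obtain ⟨hm_int, hν₁, hν₂, C, hC, hbd⟩ := hbounds
  -- measurability of `Φ`
  have hΦm : Measurable Φ := by
    have : Φ = fun z => ∏ j : Fin 5, Complex.sqrt (z - ((e j : ℝ) : ℂ)) := funext hΦ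
    rw [this]
    have hs := measurable_csqrt
    fun_prop
  -- nonnegativity of `m`
  have hm0 : ∀ x, 0 ≤ m x := fun x => by
    rw [hm]
    refine mul_nonneg (add_nonneg zero_le_one (Finset.sum_nonneg fun k _ => ?_)) ?_
    · exact Real.rpow_nonneg (abs_nonneg _) _
    · exact Real.rpow_nonneg (by positivity) _
  refine ⟨?_, ?_⟩
  · -- (I) the simplex bulk
    intro K' B hK' hB
    -- dominating weight
    set hgt : ℝ → ℝ := (Ioo (0:ℝ) 1).indicator (fun σ : ℝ => 1 / (1 - σ) ^ 2 *
      ((1 + (σ / (1 - σ)) ^ (-(3:ℝ) / 4)) * (1 + (σ / (1 - σ)) ^ 2) ^ (-(5:ℝ) / 4))) with hhgt_def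
    have hhgt : Integrable hgt := integrable_heightIndicator hν₂
    have hPm : Integrable (fun p : ℝ × ℝ => m (p.2 - p.1) * m p.2) := integrable_shear hm_int
    have hW : Integrable (fun w : Fin 3 → ℝ =>
        (3 / 2 * C ^ 2) * (hgt (w 2) * (m (w 1 - w 0) * m (w 1)))) :=
      (integrable_fin3_of_prod hhgt hPm).const_mul (3 / 2 * C ^ 2)
    -- measurability of `B`
    have hK'm : Measurable (fun q : ℝ × ℝ × ℝ => K' q.1 q.2.1 q.2.2) := by
      have : (fun q : ℝ × ℝ × ℝ => K' q.1 q.2.1 q.2.2) = fun q : ℝ × ℝ × ℝ =>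
          (1 - ((q.2.1 : ℂ) + (q.2.2 : ℂ) * Complex.I) / 2 *
            ∑ j : Fin 5, (((q.1 : ℂ) + (q.2.2 : ℂ) * Complex.I - ((e j : ℝ) : ℂ))⁻¹ +
              ((q.2.1 : ℂ) + (q.2.2 : ℂ) * Complex.I - ((e j : ℝ) : ℂ))⁻¹)) /
          (Φ ((q.1 : ℂ) + (q.2.2 : ℂ) * Complex.I) * Φ ((q.2.1 : ℂ) + (q.2.2 : ℂ) * Complex.I)) :=
        funext fun q => hK' q.1 q.2.1 q.2.2
      rw [this]
      fun_prop
    have hBm : Measurable B := by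
      have hcoord : Measurable (fun w : Fin 3 → ℝ => (w 1 - w 0, w 1, w 2 / (1 - w 2))) := by
        fun_prop
      have hcomp := Complex.measurable_re.comp (hK'm.comp hcoord)
      have : B = fun w : Fin 3 → ℝ => 1 / (1 - w 2) ^ 2 *
          ((fun q : ℝ × ℝ × ℝ => K' q.1 q.2.1 q.2.2) (w 1 - w 0, w 1, w 2 / (1 - w 2))).re :=
        funext fun w => hB w
      rw [this]
      exact ((measurable_const.div ((measurable_const.sub (measurable_pi_apply 2)).pow_const 2)).mul
        hcomp)
    -- the good set
    set S : Set (Fin 3 → ℝ) :=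
      {w | (0 < w 2 ∧ w 2 < 1) ∧ ∀ j, w 1 ≠ (e j : ℝ) ∧ w 1 - w 0 ≠ (e j : ℝ)} with hS_def
    have hSm : MeasurableSet S := by
      have h0 : Measurable fun w : Fin 3 → ℝ => w 0 := measurable_pi_apply 0
      have h1 : Measurable fun w : Fin 3 → ℝ => w 1 := measurable_pi_apply 1
      have h2 : Measurable fun w : Fin 3 → ℝ => w 2 := measurable_pi_apply 2
      have hS' : S = ({w : Fin 3 → ℝ | 0 < w 2} ∩ {w | w 2 < 1}) ∩
          ⋂ j : Fin 5, ({w : Fin 3 → ℝ | w 1 = (e j : ℝ)}ᶜ ∩ {w | w 1 - w 0 = (e j : ℝ)}ᶜ) := by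
        ext w
        simp [hS_def]
      rw [hS']
      refine ((measurableSet_lt measurable_const h2).inter (measurableSet_lt h2 measurable_const)).inter
        (MeasurableSet.iInter fun j => ?_)
      exact (measurableSet_eq_fun h1 measurable_const).compl.inter
        (measurableSet_eq_fun (h1.sub h0) measurable_const).compl
    -- the pointwise bound on the good set
    have hbound : ∀ w ∈ S, ‖B w‖ ≤ (3 / 2 * C ^ 2) * (hgt (w 2) * (m (w 1 - w 0) * m (w 1))) := by
      intro w hw
      obtain ⟨⟨hσ0, hσ1⟩, hgood⟩ := hw
      have h1σ : 0 < 1 - w 2 := sub_pos.2 hσ1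
      have hs : 0 < w 2 / (1 - w 2) := div_pos hσ0 h1σ
      have hx₀ : ∀ j, w 1 - w 0 ≠ (e j : ℝ) := fun j => (hgood j).2
      have hx₁ : ∀ j, w 1 ≠ (e j : ℝ) := fun j => (hgood j).1
      have hK := stub_kernelIntegrableAux e Φ m C hbd (w 1 - w 0) (w 1) (w 2 / (1 - w 2)) hs hx₀ hx₁
      rw [← hK'] at hK
      have hind : hgt (w 2) = 1 / (1 - w 2) ^ 2 *
          ((1 + (w 2 / (1 - w 2)) ^ (-(3:ℝ) / 4)) * (1 + (w 2 / (1 - w 2)) ^ 2) ^ (-(5:ℝ) / 4)) := by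
        rw [hhgt_def, indicator_of_mem (show w 2 ∈ Ioo (0:ℝ) 1 from ⟨hσ0, hσ1⟩)]
      have hfac : 0 ≤ 1 / (1 - w 2) ^ 2 := by positivity
      rw [hB, Real.norm_eq_abs, abs_mul, abs_of_nonneg hfac, hind]
      calc 1 / (1 - w 2) ^ 2 * |(K' (w 1 - w 0) (w 1) (w 2 / (1 - w 2))).re|
          ≤ 1 / (1 - w 2) ^ 2 * ‖K' (w 1 - w 0) (w 1) (w 2 / (1 - w 2))‖ :=
            mul_le_mul_of_nonneg_left (Complex.abs_re_le_norm _) hfac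
        _ ≤ 1 / (1 - w 2) ^ 2 * (3 / 2 * C ^ 2 * m (w 1 - w 0) * m (w 1) *
              ((1 + (w 2 / (1 - w 2)) ^ (-(3:ℝ) / 4)) * (1 + (w 2 / (1 - w 2)) ^ 2) ^ (-(5:ℝ) / 4))) :=
            mul_le_mul_of_nonneg_left hK hfac
        _ = (3 / 2 * C ^ 2) * (1 / (1 - w 2) ^ 2 *
              ((1 + (w 2 / (1 - w 2)) ^ (-(3:ℝ) / 4)) * (1 + (w 2 / (1 - w 2)) ^ 2) ^ (-(5:ℝ) / 4)) *
              (m (w 1 - w 0) * m (w 1))) := by ring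
    have hIS : IntegrableOn B S :=
      Integrable.mono' hW.integrableOn hBm.aestronglyMeasurable
        ((ae_restrict_iff' hSm).2 (Eventually.of_forall hbound))
    refine integrableOn_of_subset_union_null hIS (volume_badSimplex e) ?_
    intro w hw
    by_cases hgood : ∀ j, w 1 ≠ (e j : ℝ) ∧ w 1 - w 0 ≠ (e j : ℝ)
    · exact Or.inl ⟨⟨hw.2.1, hw.2.2⟩, hgood⟩
    · right
      push Not at hgood
      obtain ⟨j, hj⟩ := hgood
      by_cases h1 : w 1 = (e j : ℝ)
      · exact ⟨j, Or.inl h1⟩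
      · exact ⟨j, Or.inr (hj h1)⟩
  · -- (II) the spectator bulk
    intro ρ k' B hρ hk' hB L
    set hgt : ℝ → ℝ := (Ioo (0:ℝ) 1).indicator (fun σ : ℝ => 1 / (1 - σ) ^ 2 *
      ((1 + (σ / (1 - σ)) ^ (-(3:ℝ) / 4)) * (1 + (σ / (1 - σ)) ^ 2) ^ (-(5:ℝ) / 8))) with hhgt_def
    have hhgt : Integrable hgt := integrable_heightIndicator hν₁
    have hPm : Integrable (fun p : ℝ × ℝ => m p.1 * m p.2) := integrable_prod hm_int
    have hW : Integrable (fun w : Fin 3 → ℝ => C ^ 2 * (hgt (w 2) * (m (w 0) * m (w 1)))) :=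
      (integrable_fin3_of_prod hhgt hPm).const_mul (C ^ 2)
    -- measurability of `B`
    have hk'm : Measurable (fun q : ℝ × ℝ => k' q.1 q.2) := by
      have : (fun q : ℝ × ℝ => k' q.1 q.2) = fun q : ℝ × ℝ =>
          (1 - ((q.1 : ℂ) + (q.2 : ℂ) * Complex.I) / 2 *
            ∑ j : Fin 5, ((q.1 : ℂ) + (q.2 : ℂ) * Complex.I - ((e j : ℝ) : ℂ))⁻¹) /
          Φ ((q.1 : ℂ) + (q.2 : ℂ) * Complex.I) :=
        funext fun q => hk' q.1 q.2
      rw [this]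
      fun_prop
    have hρm : Measurable ρ := by
      have : ρ = fun t => 1 / Real.sqrt |∏ i : Fin 5, (t - (e i : ℝ))| := funext hρ
      rw [this]
      fun_prop
    have hBm : Measurable B := by
      have hcoord : Measurable (fun w : Fin 3 → ℝ => (w 1, w 2 / (1 - w 2))) := by fun_prop
      have hcomp := Complex.measurable_im.comp (hk'm.comp hcoord)
      have : B = fun w : Fin 3 → ℝ => -(1 / (1 - w 2) ^ 2 * ρ (w 0) *
          ((fun q : ℝ × ℝ => k' q.1 q.2) (w 1, w 2 / (1 - w 2))).im) :=
        funext fun w => hB w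
      rw [this]
      exact (((measurable_const.div ((measurable_const.sub (measurable_pi_apply 2)).pow_const 2)).mul
        (hρm.comp (measurable_pi_apply 0))).mul hcomp).neg
    -- the good set
    set S : Set (Fin 3 → ℝ) :=
      {w | (0 < w 2 ∧ w 2 < 1) ∧ ∀ j, w 0 ≠ (e j : ℝ) ∧ w 1 ≠ (e j : ℝ)} with hS_def
    have hSm : MeasurableSet S := by
      have h0 : Measurable fun w : Fin 3 → ℝ => w 0 := measurable_pi_apply 0
      have h1 : Measurable fun w : Fin 3 → ℝ => w 1 := measurable_pi_apply 1
      have h2 : Measurable fun w : Fin 3 → ℝ => w 2 := measurable_pi_apply 2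
      have hS' : S = ({w : Fin 3 → ℝ | 0 < w 2} ∩ {w | w 2 < 1}) ∩
          ⋂ j : Fin 5, ({w : Fin 3 → ℝ | w 0 = (e j : ℝ)}ᶜ ∩ {w | w 1 = (e j : ℝ)}ᶜ) := by
        ext w
        simp [hS_def]
      rw [hS']
      refine ((measurableSet_lt measurable_const h2).inter (measurableSet_lt h2 measurable_const)).inter
        (MeasurableSet.iInter fun j => ?_)
      exact (measurableSet_eq_fun h0 measurable_const).compl.inter
        (measurableSet_eq_fun h1 measurable_const).compl
    -- |ρ| is dominated by `C m` off the branch points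
    have hρle : ∀ t : ℝ, (∀ j, t ≠ (e j : ℝ)) → |ρ t| ≤ C * m t := by
      intro t ht
      obtain ⟨hB0, -, -⟩ := hbd t 0 le_rfl ht
      have hB0' : ‖(Φ (t : ℂ))⁻¹‖ ≤ C * m t := by
        simpa using hB0
      have hρt : |ρ t| = ‖(Φ (t : ℂ))⁻¹‖ := by
        rw [hρ, norm_inv, norm_Phi_real hΦ t, abs_of_nonneg (by positivity)]
        rw [one_div]
      rw [hρt]
      exact hB0'
    -- the pointwise bound on the good set
    have hbound : ∀ w ∈ S, ‖B w‖ ≤ C ^ 2 * (hgt (w 2) * (m (w 0) * m (w 1))) := by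
      intro w hw
      obtain ⟨⟨hσ0, hσ1⟩, hgood⟩ := hw
      have h1σ : 0 < 1 - w 2 := sub_pos.2 hσ1
      have hs : 0 < w 2 / (1 - w 2) := div_pos hσ0 h1σ
      have hx₀ : ∀ j, w 0 ≠ (e j : ℝ) := fun j => (hgood j).1
      have hx₁ : ∀ j, w 1 ≠ (e j : ℝ) := fun j => (hgood j).2
      obtain ⟨-, -, hB'⟩ := hbd (w 1) (w 2 / (1 - w 2)) hs.le hx₁
      obtain ⟨-, hB1'⟩ := hB' hs
      rw [← hk'] at hB1'
      have hρw := hρle (w 0) hx₀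
      have hind : hgt (w 2) = 1 / (1 - w 2) ^ 2 *
          ((1 + (w 2 / (1 - w 2)) ^ (-(3:ℝ) / 4)) * (1 + (w 2 / (1 - w 2)) ^ 2) ^ (-(5:ℝ) / 8)) := by
        rw [hhgt_def, indicator_of_mem (show w 2 ∈ Ioo (0:ℝ) 1 from ⟨hσ0, hσ1⟩)]
      have hfac : 0 ≤ 1 / (1 - w 2) ^ 2 := by positivity
      rw [hB, norm_neg, Real.norm_eq_abs, abs_mul, abs_mul, abs_of_nonneg hfac, hind]
      calc 1 / (1 - w 2) ^ 2 * |ρ (w 0)| * |(k' (w 1) (w 2 / (1 - w 2))).im|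
          ≤ 1 / (1 - w 2) ^ 2 * (C * m (w 0)) * ‖k' (w 1) (w 2 / (1 - w 2))‖ :=
            mul_le_mul (mul_le_mul_of_nonneg_left hρw hfac) (Complex.abs_im_le_norm _)
              (abs_nonneg _) (mul_nonneg hfac (le_trans (abs_nonneg _) hρw))
        _ ≤ 1 / (1 - w 2) ^ 2 * (C * m (w 0)) * (C * m (w 1) * (1 + (w 2 / (1 - w 2)) ^ (-(3:ℝ) / 4)) *
              (1 + (w 2 / (1 - w 2)) ^ 2) ^ (-(5:ℝ) / 8)) :=
            mul_le_mul_of_nonneg_left hB1' (mul_nonneg hfac (le_trans (abs_nonneg _) hρw))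
        _ = C ^ 2 * (1 / (1 - w 2) ^ 2 *
              ((1 + (w 2 / (1 - w 2)) ^ (-(3:ℝ) / 4)) * (1 + (w 2 / (1 - w 2)) ^ 2) ^ (-(5:ℝ) / 8)) *
              (m (w 0) * m (w 1))) := by ring
    have hIS : IntegrableOn B S :=
      Integrable.mono' hW.integrableOn hBm.aestronglyMeasurable
        ((ae_restrict_iff' hSm).2 (Eventually.of_forall hbound))
    refine integrableOn_of_subset_union_null hIS (volume_badSpectator e) ?_
    intro w hw
    by_cases hgood : ∀ j, w 0 ≠ (e j : ℝ) ∧ w 1 ≠ (e j : ℝ)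
    · exact Or.inl ⟨⟨hw.2.1, hw.2.2⟩, hgood⟩
    · right
      push Not at hgood
      obtain ⟨j, hj⟩ := hgood
      by_cases h0 : w 0 = (e j : ℝ)
      · exact ⟨j, Or.inl h0⟩
      · exact ⟨j, Or.inr (hj h0)⟩

end Summit.KontsevichZagierPeriods.UnfoldedStokes.HyperellipticRiemannRelationLine
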